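import Literature.RepresentationTheory.CompactGroups.WeylIntegrationCoordinates
import Literature.Probability.LatticeModels.BesselIDebyeAsymptotics
import Mathlib.Analysis.SpecialFunctions.Gaussian.GaussianIntegral
import Mathlib.Analysis.SpecialFunctions.Trigonometric.Bounds
import Mathlib.MeasureTheory.Integral.Pi
import HarnessLib

/-!
# Laplace's method on Weyl's torus, I: the one-dimensional lemmas (`x(cos(a/√x) − 1) → −a²/2`, Gaussian domination on `|a| ≤ π√x`), `|n| + 2|{j ≺ k}| = |n|²`, and the integrable dominating function `2^{|OD|} Π_b e^{−(2/π²)φ_b²}(1 + φ_b²)^{|OD|}`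

HONEST FRAMING: exact (Metropolis-corrected) sampling algorithms for lattice gauge theory;
figures of merit are autocorrelation/cost numbers at stated couplings and volumes; no
continuum-physics claim.

Venture `LatticeQCDFlow` (cell pub-lqcd), sub-topic `Scoring`; FANOUT row 5 (`s0-sun-a`), GEN-20.
NEW WORK of the cell (placement rule).  The elementary inputs of the weak-coupling (`x → ∞`) law of the `U(N)`
one-plaquette partition function `det[I_{|i−j|}(x)]_{N×N} = ((2π)^N N!)⁻¹ ∫_{(−π,π]^N} e^{xΣcos θ_b} Π_{j≺k}|e^{iθ_j} − e^{iθ_k}|² dθ`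
(GEN-17 `BesselToeplitzAndreief`) by Laplace's method (substitute `θ = φ/√x`; sibling file `BesselToeplitzLaplace`):

* §1 `norm_cexp_sub_cexp_sq` (`|e^{is} − e^{it}|² = 2 − 2cos(s − t)`), `mul_div_sqrt_sq`,
  `neg_sq_div_two_le_mul_cos_div_sqrt_sub_one` / `mul_cos_div_sqrt_sub_one_le_quartic`
  (`−a²/2 ≤ x(cos(a/√x) − 1) ≤ −a²/2 + a⁴/(24x)`), `mul_cos_div_sqrt_sub_one_le` (`≤ −(2/π²)a²` for `|a/√x| ≤ π`:
  Gaussian domination on the whole torus), **`tendsto_mul_cos_div_sqrt_sub_one`** (`x(cos(a/√x) − 1) → −a²/2`),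
  **`tendsto_pairFactor`** (`2x(1 − cos((a−b)/√x)) → (a − b)²`), `pairFactor_nonneg`, `pairFactor_le_sq`, `sub_sq_le_two_mul`,
  `one_add_sq_pow_mul_exp_le` (`(1+t²)^m e^{−ct²} ≤ m!(2/c)^m e^{c/2} e^{−(c/2)t²}`);
* §2 `card_add_two_mul_card_OD` (`|n| + 2·|OD n| = |n|²` for the tree's ordered pairs `OD n = {j ≺ k}`);
* §3 the dominating function: `prod_le_laplacePoly` (`Π_{j≺k} g_{jk} ≤ 2^{|OD|} Π_b (1+φ_b²)^{|OD|}` whenever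
  `0 ≤ g_{jk} ≤ (φ_j − φ_k)²`), `mul_prod_le_laplaceBound`, **`integrable_laplaceBound`**
  (`2^{|OD|} Π_b e^{−(2/π²)φ_b²}(1 + φ_b²)^{|OD|}` is integrable on `ℝ^N`, `Integrable.fintype_prod`).

No `def`, nothing cited as a fact, 0 sorry.
-/

noncomputable section

open Real MeasureTheory Filter Topology Finset
open Complex (I exp_mul_I)
open Literature.RepresentationTheory.CompactGroups.WeylIntegration (OD enum)

namespace Summit.Ventures.LatticeQCDFlow.Scoring

/-! ### 1. One-dimensional lemmas -/

/-- `|e^{is} − e^{it}|² = 2 − 2cos(s − t)`. -/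
theorem norm_cexp_sub_cexp_sq (s t : ℝ) :
    ‖Complex.exp (s * I) - Complex.exp (t * I)‖ ^ 2 = 2 - 2 * Real.cos (s - t) := by
  have h : Complex.exp (s * I) - Complex.exp (t * I)
      = ((Real.cos s - Real.cos t : ℝ) : ℂ) + ((Real.sin s - Real.sin t : ℝ) : ℂ) * I := by
    rw [exp_mul_I, exp_mul_I, ← Complex.ofReal_cos, ← Complex.ofReal_sin, ← Complex.ofReal_cos,
      ← Complex.ofReal_sin]
    push_cast
    ring
  rw [h, Complex.norm_add_mul_I, Real.sq_sqrt (by positivity), Real.cos_sub]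
  nlinarith [Real.sin_sq_add_cos_sq s, Real.sin_sq_add_cos_sq t]

/-- For `x > 0`: `x · (a/√x)² = a²`. -/
theorem mul_div_sqrt_sq {x : ℝ} (hx : 0 < x) (a : ℝ) : x * (a / √x) ^ 2 = a ^ 2 := by
  rw [div_pow, Real.sq_sqrt hx.le]
  field_simp

/-- Lower bound: `−a²/2 ≤ x (cos(a/√x) − 1)` for `x > 0` (`1 − u²/2 ≤ cos u`). -/
theorem neg_sq_div_two_le_mul_cos_div_sqrt_sub_one {x : ℝ} (hx : 0 < x) (a : ℝ) :
    -(a ^ 2 / 2) ≤ x * (Real.cos (a / √x) - 1) := by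
  have h := Real.one_sub_sq_div_two_le_cos (x := a / √x)
  have h2 := mul_div_sqrt_sq hx a
  nlinarith

/-- Upper bound: `x (cos(a/√x) − 1) ≤ −a²/2 + a⁴/(24x)` for `x > 0` (`cos u ≤ 1 − u²/2 + u⁴/24`). -/
theorem mul_cos_div_sqrt_sub_one_le_quartic {x : ℝ} (hx : 0 < x) (a : ℝ) :
    x * (Real.cos (a / √x) - 1) ≤ -(a ^ 2 / 2) + a ^ 4 / (24 * x) := by
  have h := Literature.Probability.LatticeModels.cos_le_one_sub_sq_half_add_fourth (a / √x)
  have h2 := mul_div_sqrt_sq hx a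
  have h4 : x * (a / √x) ^ 4 = a ^ 4 / x := by
    have : (a / √x) ^ 4 = ((a / √x) ^ 2) ^ 2 := by ring
    rw [this, eq_div_iff hx.ne']
    nlinarith [h2]
  have e : x * (1 - (a / √x) ^ 2 / 2 + (a / √x) ^ 4 / 24) = x - a ^ 2 / 2 + a ^ 4 / (24 * x) := by
    have : x * (1 - (a / √x) ^ 2 / 2 + (a / √x) ^ 4 / 24)
        = x - (x * (a / √x) ^ 2) / 2 + (x * (a / √x) ^ 4) / 24 := by ring
    rw [this, h2, h4, div_div, mul_comm x 24]
  have hmul := mul_le_mul_of_nonneg_left h hx.le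
  rw [e] at hmul
  rw [mul_sub, mul_one]
  linarith

/-- Gaussian domination: `x (cos(a/√x) − 1) ≤ −(2/π²) a²` when `|a/√x| ≤ π`, `x > 0` (`cos u ≤ 1 − (2/π²)u²` on `|u| ≤ π`). -/
theorem mul_cos_div_sqrt_sub_one_le {x : ℝ} (hx : 0 < x) {a : ℝ} (ha : |a / √x| ≤ π) :
    x * (Real.cos (a / √x) - 1) ≤ -(2 / π ^ 2 * a ^ 2) := by
  have h := Real.cos_le_one_sub_mul_cos_sq ha
  have h2 := mul_div_sqrt_sq hx a
  have hπ : 0 < 2 / π ^ 2 := by positivity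
  nlinarith [mul_le_mul_of_nonneg_left h hx.le]

/-- **`x (cos(a/√x) − 1) → −a²/2`** as `x → ∞`. -/
theorem tendsto_mul_cos_div_sqrt_sub_one (a : ℝ) :
    Tendsto (fun x : ℝ => x * (Real.cos (a / √x) - 1)) atTop (𝓝 (-(a ^ 2 / 2))) := by
  have hup : Tendsto (fun x : ℝ => -(a ^ 2 / 2) + a ^ 4 / (24 * x)) atTop (𝓝 (-(a ^ 2 / 2))) := by
    have h : Tendsto (fun x : ℝ => a ^ 4 / (24 * x)) atTop (𝓝 0) :=
      tendsto_const_nhds.div_atTop (tendsto_id.const_mul_atTop (by norm_num : (0 : ℝ) < 24))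
    simpa using h.const_add (-(a ^ 2 / 2))
  refine tendsto_of_tendsto_of_tendsto_of_le_of_le' tendsto_const_nhds hup ?_ ?_
  · filter_upwards [eventually_gt_atTop (0 : ℝ)] with x hx
    exact neg_sq_div_two_le_mul_cos_div_sqrt_sub_one hx a
  · filter_upwards [eventually_gt_atTop (0 : ℝ)] with x hx
    exact mul_cos_div_sqrt_sub_one_le_quartic hx a

/-- **The pair factor**: `2x (1 − cos((a − b)/√x)) → (a − b)²` as `x → ∞`. -/
theorem tendsto_pairFactor (a b : ℝ) :
    Tendsto (fun x : ℝ => 2 * x * (1 - Real.cos ((a - b) / √x))) atTop (𝓝 ((a - b) ^ 2)) := by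
  have h := (tendsto_mul_cos_div_sqrt_sub_one (a - b)).const_mul (-2)
  refine (h.congr fun x => by ring).trans ?_
  rw [show -2 * -((a - b) ^ 2 / 2) = (a - b) ^ 2 by ring]

/-- The pair factor is non-negative for `x ≥ 0`. -/
theorem pairFactor_nonneg {x : ℝ} (hx : 0 ≤ x) (d : ℝ) : 0 ≤ 2 * x * (1 - Real.cos (d / √x)) := by
  have := Real.cos_le_one (d / √x)
  positivity

/-- The pair factor is at most `d²` (`1 − cos u ≤ u²/2`), `x > 0`. -/
theorem pairFactor_le_sq {x : ℝ} (hx : 0 < x) (d : ℝ) : 2 * x * (1 - Real.cos (d / √x)) ≤ d ^ 2 := by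
  have h := neg_sq_div_two_le_mul_cos_div_sqrt_sub_one hx d
  nlinarith

/-- `d² ≤ 2 (1 + a²)(1 + b²)` for `d = a − b`. -/
theorem sub_sq_le_two_mul (a b : ℝ) : (a - b) ^ 2 ≤ 2 * ((1 + a ^ 2) * (1 + b ^ 2)) := by
  nlinarith [sq_nonneg (a + b), sq_nonneg (a * b), sq_nonneg a, sq_nonneg b]

/-- `(1 + t²)^m e^{−c t²} ≤ m! (2/c)^m e^{c/2} · e^{−(c/2) t²}` for `c > 0` (`y^m/m! ≤ e^y` at `y = (c/2)(1 + t²)`). -/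
theorem one_add_sq_pow_mul_exp_le {c : ℝ} (hc : 0 < c) (m : ℕ) (t : ℝ) :
    (1 + t ^ 2) ^ m * Real.exp (-(c * t ^ 2))
      ≤ (m.factorial * (2 / c) ^ m * Real.exp (c / 2)) * Real.exp (-(c / 2 * t ^ 2)) := by
  have hy : 0 ≤ c / 2 * (1 + t ^ 2) := by positivity
  have h := Real.pow_div_factorial_le_exp _ hy m
  have hm : (0 : ℝ) < m.factorial := by exact_mod_cast Nat.factorial_pos m
  rw [div_le_iff₀ hm, mul_pow] at h
  -- `(1+t²)^m ≤ m! (2/c)^m e^{(c/2)(1+t²)}`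
  have h1 : (1 + t ^ 2) ^ m ≤ m.factorial * (2 / c) ^ m * Real.exp (c / 2 * (1 + t ^ 2)) := by
    have hc2 : (0 : ℝ) < (c / 2) ^ m := by positivity
    have : (1 + t ^ 2) ^ m = (2 / c) ^ m * ((c / 2) ^ m * (1 + t ^ 2) ^ m) := by
      rw [← mul_assoc, ← mul_pow, show 2 / c * (c / 2) = 1 by field_simp, one_pow, one_mul]
    rw [this]
    calc (2 / c) ^ m * ((c / 2) ^ m * (1 + t ^ 2) ^ m) ≤ (2 / c) ^ m * (Real.exp (c / 2 * (1 + t ^ 2)) * m.factorial) :=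
          mul_le_mul_of_nonneg_left h (by positivity)
      _ = m.factorial * (2 / c) ^ m * Real.exp (c / 2 * (1 + t ^ 2)) := by ring
  have hsplit : (m.factorial * (2 / c) ^ m * Real.exp (c / 2)) * Real.exp (-(c / 2 * t ^ 2))
      = m.factorial * (2 / c) ^ m * Real.exp (c / 2 * (1 + t ^ 2)) * Real.exp (-(c * t ^ 2)) := by
    rw [mul_assoc (↑m.factorial * (2 / c) ^ m) (Real.exp (c / 2)), ← Real.exp_add,
      mul_assoc (↑m.factorial * (2 / c) ^ m) _ (Real.exp (-(c * t ^ 2))), ← Real.exp_add]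
    congr 2
    ring
  rw [hsplit]
  exact mul_le_mul_of_nonneg_right h1 (Real.exp_nonneg _)

/-! ### 2. `|n| + 2 |{j ≺ k}| = |n|²` -/

section Card

variable {n : Type*} [Fintype n] [DecidableEq n]

/-- `|n| + 2·|OD n| = |n|²`: the ordered pairs `j ≺ k` (for the tree's enumeration) are half of the off-diagonal. -/
theorem card_add_two_mul_card_OD : Fintype.card n + 2 * Fintype.card (OD n) = Fintype.card n ^ 2 := by
  classical
  have hOD : Fintype.card (OD n) = (Finset.univ.filter fun p : n × n => enum n p.1 < enum n p.2).card := by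
    rw [Fintype.card_subtype]
  set A := Finset.univ.filter fun p : n × n => enum n p.1 < enum n p.2 with hA
  set B := Finset.univ.filter fun p : n × n => enum n p.2 < enum n p.1 with hB
  set D := Finset.univ.filter fun p : n × n => p.1 = p.2 with hD
  have hAB : A.card = B.card := by
    refine Finset.card_bij (fun p _ => p.swap) (fun p hp => ?_) (fun p _ q _ h => ?_) (fun q hq => ?_)
    · simp only [hA, hB, Finset.mem_filter, Finset.mem_univ, true_and] at hp ⊢
      simpa using hp
    · exact Prod.swap_injective h
    · refine ⟨q.swap, ?_, by simp⟩
      simp only [hA, hB, Finset.mem_filter, Finset.mem_univ, true_and] at hq ⊢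
      simpa using hq
  have hDcard : D.card = Fintype.card n := by
    rw [hD, ← Finset.card_univ (α := n), ← Finset.card_image_of_injective Finset.univ
      (f := fun i : n => (i, i)) (fun i j h => (Prod.mk.inj h).1)]
    congr 1
    ext p
    simp only [Finset.mem_filter, Finset.mem_univ, true_and, Finset.mem_image]
    constructor
    · intro h; exact ⟨p.1, by ext <;> simp [h]⟩
    · rintro ⟨i, rfl⟩; rfl
  -- the three sets partition `n × n`
  have hdisj1 : Disjoint A B := by
    rw [Finset.disjoint_filter]; intro p _ h1 h2; exact lt_asymm h1 h2
  have hdisj2 : Disjoint (A ∪ B) D := by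
    rw [Finset.disjoint_left]
    intro p hp hpD
    simp only [hD, Finset.mem_filter, Finset.mem_univ, true_and] at hpD
    rcases Finset.mem_union.1 hp with h | h <;>
      simp only [hA, hB, Finset.mem_filter, Finset.mem_univ, true_and, hpD] at h <;> exact lt_irrefl _ h
  have hunion : A ∪ B ∪ D = Finset.univ := by
    ext p
    simp only [Finset.mem_union, hA, hB, hD, Finset.mem_filter, Finset.mem_univ, true_and, iff_true]
    rcases lt_trichotomy (enum n p.1) (enum n p.2) with h | h | h
    · exact Or.inl (Or.inl h)
    · exact Or.inr ((enum n).injective h)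
    · exact Or.inl (Or.inr h)
  have hcard := congrArg Finset.card hunion
  rw [Finset.card_union_of_disjoint hdisj2, Finset.card_union_of_disjoint hdisj1, Finset.card_univ,
    Fintype.card_prod, hDcard, ← hAB] at hcard
  rw [hOD, sq]
  omega

end Card

/-! ### 3. The dominating function -/

section Bound

variable {n : Type*} [Fintype n]

/-- `Π_{j≺k} g_{jk} ≤ 2^{|OD|} Π_b (1 + φ_b²)^{|OD|}` whenever `0 ≤ g_{jk} ≤ (φ_j − φ_k)²` (each pair factor is at most
`2(1+φ_j²)(1+φ_k²) ≤ 2 Π_b (1+φ_b²)`). -/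
theorem prod_le_laplacePoly (φ : n → ℝ) {g : OD n → ℝ} (hg0 : ∀ p, 0 ≤ g p)
    (hg : ∀ p : OD n, g p ≤ (φ p.1.1 - φ p.1.2) ^ 2) :
    ∏ p, g p ≤ 2 ^ Fintype.card (OD n) * ∏ b, (1 + φ b ^ 2) ^ Fintype.card (OD n) := by
  classical
  have hP1 : ∀ b, (1 : ℝ) ≤ 1 + φ b ^ 2 := fun b => by nlinarith [sq_nonneg (φ b)]
  set P : ℝ := ∏ b, (1 + φ b ^ 2) with hP
  have hpair : ∀ p : OD n, g p ≤ 2 * P := by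
    intro p
    refine (hg p).trans ((sub_sq_le_two_mul _ _).trans (mul_le_mul_of_nonneg_left ?_ (by norm_num)))
    have hne : p.1.1 ≠ p.1.2 := fun h => by have := p.2; rw [h] at this; exact lt_irrefl _ this
    rw [hP, ← Finset.prod_pair (f := fun b => 1 + φ b ^ 2) hne]
    exact Finset.prod_le_prod_of_subset_of_one_le (Finset.subset_univ _) (fun b _ => (hP1 b).trans' zero_le_one)
      fun b _ _ => hP1 b
  have hc : ∏ _p : OD n, (2 * P) = (2 * P) ^ Fintype.card (OD n) := by rw [Finset.prod_const, Finset.card_univ]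
  calc ∏ p, g p ≤ ∏ _p : OD n, (2 * P) := Finset.prod_le_prod (fun p _ => hg0 p) fun p _ => hpair p
    _ = 2 ^ Fintype.card (OD n) * ∏ b, (1 + φ b ^ 2) ^ Fintype.card (OD n) := by
        rw [hc, mul_pow, hP, Finset.prod_pow]

/-- The Laplace bound: if `E ≤ Π_b e^{−(2/π²)φ_b²}` and `0 ≤ g_{jk} ≤ (φ_j − φ_k)²`, then
`E · Π_{j≺k} g_{jk} ≤ 2^{|OD|} Π_b e^{−(2/π²)φ_b²}(1 + φ_b²)^{|OD|}`. -/
theorem mul_prod_le_laplaceBound (φ : n → ℝ) {E : ℝ}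
    (hE : E ≤ ∏ b, Real.exp (-(2 / π ^ 2 * φ b ^ 2))) {g : OD n → ℝ} (hg0 : ∀ p, 0 ≤ g p)
    (hg : ∀ p : OD n, g p ≤ (φ p.1.1 - φ p.1.2) ^ 2) :
    E * ∏ p, g p ≤ 2 ^ Fintype.card (OD n) * ∏ b, (Real.exp (-(2 / π ^ 2 * φ b ^ 2)) * (1 + φ b ^ 2) ^ Fintype.card (OD n)) := by
  calc E * ∏ p, g p ≤ (∏ b, Real.exp (-(2 / π ^ 2 * φ b ^ 2))) *
        (2 ^ Fintype.card (OD n) * ∏ b, (1 + φ b ^ 2) ^ Fintype.card (OD n)) :=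
        mul_le_mul hE (prod_le_laplacePoly φ hg0 hg) (Finset.prod_nonneg fun p _ => hg0 p)
          (Finset.prod_nonneg fun b _ => (Real.exp_pos _).le)
    _ = 2 ^ Fintype.card (OD n) * ∏ b, (Real.exp (-(2 / π ^ 2 * φ b ^ 2)) * (1 + φ b ^ 2) ^ Fintype.card (OD n)) := by
        rw [Finset.prod_mul_distrib]
        ring

/-- The dominating function `2^{|OD|} Π_b e^{−(2/π²)φ_b²}(1+φ_b²)^{|OD|}` is integrable on `ℝ^N`. -/
theorem integrable_laplaceBound :
    Integrable (fun φ : n → ℝ => (2 : ℝ) ^ Fintype.card (OD n) *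
      ∏ b, (Real.exp (-(2 / π ^ 2 * φ b ^ 2)) * (1 + φ b ^ 2) ^ Fintype.card (OD n))) := by
  refine Integrable.const_mul ?_ _
  rw [volume_pi]
  refine Integrable.fintype_prod (f := fun _ t => Real.exp (-(2 / π ^ 2 * t ^ 2)) * (1 + t ^ 2) ^ Fintype.card (OD n))
    fun b => ?_
  have hc : (0 : ℝ) < 2 / π ^ 2 := by positivity
  set m := Fintype.card (OD n)
  have hg : Integrable (fun t : ℝ => (m.factorial * (2 / (2 / π ^ 2)) ^ m * Real.exp ((2 / π ^ 2) / 2)) *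
      Real.exp (-((2 / π ^ 2) / 2 * t ^ 2))) := by
    refine Integrable.const_mul ?_ _
    have h := integrable_exp_neg_mul_sq (b := (2 / π ^ 2) / 2) (by positivity)
    refine h.congr (Eventually.of_forall fun t => ?_)
    simp only [neg_mul]
  refine Integrable.mono' hg ((by fun_prop : Continuous fun t : ℝ =>
      Real.exp (-(2 / π ^ 2 * t ^ 2)) * (1 + t ^ 2) ^ m).aestronglyMeasurable) (Eventually.of_forall fun t => ?_)
  rw [Real.norm_eq_abs, abs_of_nonneg (by positivity), mul_comm]
  exact one_add_sq_pow_mul_exp_le hc m t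

end Bound

end Summit.Ventures.LatticeQCDFlow.Scoring
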